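import Summits.CriticalPhenomena.PercolationContinuityZ3.Theorems.Transplant.FKConnectivityAllQAntipodalRootFormBase
import Summits.CriticalPhenomena.PercolationContinuityZ3.Theorems.Transplant.FKConnectivityAllQAntipodalRootFormCertSer

/-!
# Connectivity correlation inequalities for `φ_{w,q}`, every `q > 0` — ROOT-FORM CALCULUS, file 61g: the SERIES pair `B_y · B_z` and base (B2)
# from the kernel-checked certificate

Support file (`--supports stmt-CriticalPhenomena-4575`), FK sub-lane `prim-bschramm-fk-2` (gen 28); builds on p205010 (kernel theorem, internal audit
signed; external expert review pending).  Standard axioms, no sorries.  Memo FROM-fk-2-g28-ROOT-FORM.md §4, §6 (certificate j207899), §7.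

`serPair Y Z : Env (B × B')` is the environment `B_y · B_z` of two abstract one-special boxes in series (the base of the triangle assembly Δ in root
form); `serPair_Mt_nonneg`: its nested root functional is nonnegative against every monotone nested nonnegative weight pair, given the single-box
inequalities A2 (pivot, virtual root deleted), A3n, A4n of the two boxes and the consistency of the local types — by regrouping the 42-term certificate
of file 61f box by box (`certYS_nonneg`, `certZS_nonneg`) plus the residual table `Cert.rhoS_nonneg`.  Same method as file 61e. [folklore]
-/

noncomputable section

namespace Summit.CriticalPhenomena.PercolationContinuityZ3.Theorems

namespace FK

namespace RootForm

namespace BaseSer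

open Finset Base

/-- pattern data of two boxes IN SERIES (triangle pair): levels add, poles joined in a replica iff both boxes join theirs. [folklore] -/
def combS (a b : SDat) : PDat := ⟨a.L + b.L, a.c && b.c, a.cb && b.cb⟩

/-- The environment `B_y · B_z` of two abstract boxes (configurations = pairs). [folklore] -/
def serPair {B B' : Type*} (Y : B → BDat) (Z : B' → BDat) : Env (B × B') := fun p =>
  ⟨combS (Y p.1).t0 (Z p.2).t0, combS (Y p.1).t1 (Z p.2).t0, combS (Y p.1).t0 (Z p.2).t1, combS (Y p.1).t1 (Z p.2).t1⟩

/-- real generator integrand A2 of a box (pivot, virtual root deleted), as a cast of the type-level one. [folklore] -/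
def gA2 (d : BDat) (K : ℤ) : ℝ := ((Cert.A2 d.type (K - d.t0.L) : ℤ) : ℝ)

/-- level bracket of the series pair at states `(s,s')`, replica-1 root. [folklore] -/
theorem a1_linkS (dy dz : BDat) (s s' : Bool) (J : ℤ) : (combS (dy.ts s) (dz.ts s')).a1 J =
    ((Cert.I (Cert.plamS dy.type dz.type s s' + Cert.C1S dy.type dz.type s s' ≤ J - dz.t0.L - dy.t0.L) : ℤ) : ℝ) := by
  unfold PDat.a1; refine ind_eq_cast ?_
  cases s <;> cases s' <;> simp [combS, BDat.ts, BDat.type, Cert.plamS, Cert.lev, Cert.ccB, Cert.C1S] <;> omega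
/-- level bracket of the series pair at states `(s,s')`, replica-2 root. [folklore] -/
theorem a2_linkS (dy dz : BDat) (s s' : Bool) (J : ℤ) : (combS (dy.ts s) (dz.ts s')).a2 J =
    ((Cert.I (Cert.plamS dy.type dz.type s s' + Cert.C2S dy.type dz.type s s' ≤ J - dz.t0.L - dy.t0.L) : ℤ) : ℝ) := by
  unfold PDat.a2; refine ind_eq_cast ?_
  cases s <;> cases s' <;> simp [combS, BDat.ts, BDat.type, Cert.plamS, Cert.lev, Cert.cbB, Cert.C2S] <;> omega
/-- root-exchange bracket of the series pair at states `(s,s')`, replica 1. [folklore] -/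
theorem r1_linkS (dy dz : BDat) (s s' : Bool) (J : ℤ) : (combS (dy.ts s) (dz.ts s')).r1 J =
    ((Cert.I (Cert.plamS dy.type dz.type s s' = J - dz.t0.L - dy.t0.L) * Cert.C1S dy.type dz.type s s' : ℤ) : ℝ) := by
  have hb : Cert.C1S dy.type dz.type s s' = Cert.bi ((dy.ts s).c && (dz.ts s').c) := by
    cases s <;> cases s' <;> rfl
  rw [hb]; unfold PDat.r1
  exact ind_and_eq_cast (Q := Cert.plamS dy.type dz.type s s' = J - dz.t0.L - dy.t0.L)
    (by cases s <;> cases s' <;> simp [combS, BDat.ts, BDat.type, Cert.plamS, Cert.lev] <;> omega) _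
/-- root-exchange bracket of the series pair at states `(s,s')`, replica 2. [folklore] -/
theorem r2_linkS (dy dz : BDat) (s s' : Bool) (J : ℤ) : (combS (dy.ts s) (dz.ts s')).r2 J =
    ((Cert.I (Cert.plamS dy.type dz.type s s' = J - dz.t0.L - dy.t0.L) * Cert.C2S dy.type dz.type s s' : ℤ) : ℝ) := by
  have hb : Cert.C2S dy.type dz.type s s' = Cert.bi ((dy.ts s).cb && (dz.ts s').cb) := by
    cases s <;> cases s' <;> rfl
  rw [hb]; unfold PDat.r2
  exact ind_and_eq_cast (Q := Cert.plamS dy.type dz.type s s' = J - dz.t0.L - dy.t0.L)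
    (by cases s <;> cases s' <;> simp [combS, BDat.ts, BDat.type, Cert.plamS, Cert.lev] <;> omega) _

/-- slot-1 integrand of `serPair` = cast of `X1S`. [folklore] -/
theorem slot1_linkS {B B' : Type*} (Y : B → BDat) (Z : B' → BDat) (p : B × B') (J : ℤ) :
    (serPair Y Z p).slot1 J = ((Cert.X1S (Y p.1).type (Z p.2).type (J - (Z p.2).t0.L - (Y p.1).t0.L) : ℤ) : ℝ) := by
  have e0 : (serPair Y Z p).d0 = combS ((Y p.1).ts false) ((Z p.2).ts false) := rfl
  have ey : (serPair Y Z p).dy = combS ((Y p.1).ts true) ((Z p.2).ts false) := rfl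
  have ez : (serPair Y Z p).dz = combS ((Y p.1).ts false) ((Z p.2).ts true) := rfl
  have eyz : (serPair Y Z p).dyz = combS ((Y p.1).ts true) ((Z p.2).ts true) := rfl
  simp only [EDat.slot1, e0, ey, ez, eyz, a1_linkS, r1_linkS, Cert.X1S]; push_cast; ring
/-- slot-0 integrand of `serPair` = cast of `X0S`. [folklore] -/
theorem slot0_linkS {B B' : Type*} (Y : B → BDat) (Z : B' → BDat) (p : B × B') (J : ℤ) :
    (serPair Y Z p).slot0 J = ((Cert.X0S (Y p.1).type (Z p.2).type (J - (Z p.2).t0.L - (Y p.1).t0.L) : ℤ) : ℝ) := by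
  have e0 : (serPair Y Z p).d0 = combS ((Y p.1).ts false) ((Z p.2).ts false) := rfl
  have ey : (serPair Y Z p).dy = combS ((Y p.1).ts true) ((Z p.2).ts false) := rfl
  have ez : (serPair Y Z p).dz = combS ((Y p.1).ts false) ((Z p.2).ts true) := rfl
  have eyz : (serPair Y Z p).dyz = combS ((Y p.1).ts true) ((Z p.2).ts true) := rfl
  simp only [EDat.slot0, e0, ey, ez, eyz, a2_linkS, r2_linkS, Cert.X0S]; push_cast; ring

section Halves

variable {B B' : Type*} [Fintype B] [Fintype B'] [Preorder B] [Preorder B']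

omit [Fintype B'] in
/-- the `y`-half of the (B2) certificate is nonnegative (per fixed `z`-configuration). [folklore] -/
theorem certYS_nonneg (Y : B → BDat) (Z : B' → BDat)
    (hA2 : ∀ h : B → ℝ, Monotone h → (∀ β, 0 ≤ h β) → ∀ K : ℤ, 0 ≤ ∑ β, h β * gA2 (Y β) K)
    (hA3 : ∀ h0 h1 : B → ℝ, Monotone h0 → Monotone h1 → (∀ β, 0 ≤ h0 β) → (∀ β, h0 β ≤ h1 β) → ∀ K : ℤ,
      0 ≤ ∑ β, (h1 β * gA3u (Y β) K + h0 β * gA3l (Y β) K))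
    (hA4 : ∀ h0 h1 : B → ℝ, Monotone h0 → Monotone h1 → (∀ β, 0 ≤ h0 β) → (∀ β, h0 β ≤ h1 β) → ∀ K : ℤ,
      0 ≤ ∑ β, (h1 β * gA4u (Y β) K + h0 β * gA4l (Y β) K))
    {H0 H1 : B × B' → ℝ} (m0 : Monotone H0) (m1 : Monotone H1) (n0 : ∀ p, 0 ≤ H0 p) (le : ∀ p, H0 p ≤ H1 p) (J : ℤ) (γ : B') :
    0 ≤ ∑ β, (H1 (β, γ) * ((Cert.certYS (Y β).type (Z γ).type ((J - (Z γ).t0.L) - (Y β).t0.L) ((J - (Z γ).t1.L) - (Y β).t0.L)).1 : ℝ)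
      + H0 (β, γ) * ((Cert.certYS (Y β).type (Z γ).type ((J - (Z γ).t0.L) - (Y β).t0.L) ((J - (Z γ).t1.L) - (Y β).t0.L)).2 : ℝ)) := by
  have n1 : ∀ p, 0 ≤ H1 p := fun p => (n0 p).trans (le p)
  have i21 : ∀ K, 0 ≤ ∑ β, H1 (β, γ) * gA2 (Y β) K := fun K => hA2 _ (mono_left m1 γ) (fun β => n1 _) K
  have i20 : ∀ K, 0 ≤ ∑ β, H0 (β, γ) * gA2 (Y β) K := fun K => hA2 _ (mono_left m0 γ) (fun β => n0 _) K
  have i3 : ∀ K, 0 ≤ ∑ β, H1 (β, γ) * gA3u (Y β) K + ∑ β, H0 (β, γ) * gA3l (Y β) K := fun K => by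
    rw [← Finset.sum_add_distrib]; exact hA3 _ _ (mono_left m0 γ) (mono_left m1 γ) (fun β => n0 _) (fun β => le _) K
  have i4b : ∀ K, 0 ≤ ∑ β, H0 (β, γ) * gA4u (Y β) K + ∑ β, H0 (β, γ) * gA4l (Y β) K := fun K => by
    rw [← Finset.sum_add_distrib]; exact hA4 _ _ (mono_left m0 γ) (mono_left m0 γ) (fun β => n0 _) (fun β => le_rfl) K
  have i4n : ∀ K, 0 ≤ ∑ β, H1 (β, γ) * gA4u (Y β) K + ∑ β, H0 (β, γ) * gA4l (Y β) K := fun K => by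
    rw [← Finset.sum_add_distrib]; exact hA4 _ _ (mono_left m0 γ) (mono_left m1 γ) (fun β => n0 _) (fun β => le _) K
  have a1 := i21 (J - (Z γ).t0.L); have a2 := i21 (J - (Z γ).t1.L); have a3 := i20 (J - (Z γ).t0.L); have a4 := i20 (J - (Z γ).t1.L)
  have a5 := i3 (J - (Z γ).t1.L); have a6 := i4b (J - (Z γ).t0.L); have a7 := i4n (J - (Z γ).t0.L)
  simp only [gA2, gA3u, gA3l, gA4u, gA4l] at a1 a2 a3 a4 a5 a6 a7
  generalize (Z γ) = d at *
  obtain ⟨⟨L0, c0, cb0⟩, ⟨L1, c1, cb1⟩⟩ := d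
  simp only [BDat.type] at *
  cases c0 <;> cases c1 <;> cases cb0 <;> cases cb1 <;>
    simp only [Cert.certYS, Cert.isC, Prod.mk.injEq, Bool.false_eq_true, Bool.true_eq_false, and_true, and_false,
      and_self, ite_true, ite_false, zero_mul, one_mul, mul_zero, zero_add, add_zero,
      Int.cast_add, Int.cast_zero, mul_add, Finset.sum_add_distrib] <;>
    first | positivity | linarith

omit [Fintype B] in
/-- the `z`-half of the (B2) certificate is nonnegative (per fixed `y`-configuration). [folklore] -/
theorem certZS_nonneg (Y : B → BDat) (Z : B' → BDat)
    (hB2 : ∀ h : B' → ℝ, Monotone h → (∀ γ, 0 ≤ h γ) → ∀ K : ℤ, 0 ≤ ∑ γ, h γ * gA2 (Z γ) K)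
    (hB3 : ∀ h0 h1 : B' → ℝ, Monotone h0 → Monotone h1 → (∀ γ, 0 ≤ h0 γ) → (∀ γ, h0 γ ≤ h1 γ) → ∀ K : ℤ,
      0 ≤ ∑ γ, (h1 γ * gA3u (Z γ) K + h0 γ * gA3l (Z γ) K))
    (hB4 : ∀ h0 h1 : B' → ℝ, Monotone h0 → Monotone h1 → (∀ γ, 0 ≤ h0 γ) → (∀ γ, h0 γ ≤ h1 γ) → ∀ K : ℤ,
      0 ≤ ∑ γ, (h1 γ * gA4u (Z γ) K + h0 γ * gA4l (Z γ) K))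
    {H0 H1 : B × B' → ℝ} (m0 : Monotone H0) (m1 : Monotone H1) (n0 : ∀ p, 0 ≤ H0 p) (le : ∀ p, H0 p ≤ H1 p) (J : ℤ) (β : B) :
    0 ≤ ∑ γ, (H1 (β, γ) * ((Cert.certZS (Y β).type (Z γ).type ((J - (Y β).t0.L) - (Z γ).t0.L) ((J - (Y β).t1.L) - (Z γ).t0.L)).1 : ℝ)
      + H0 (β, γ) * ((Cert.certZS (Y β).type (Z γ).type ((J - (Y β).t0.L) - (Z γ).t0.L) ((J - (Y β).t1.L) - (Z γ).t0.L)).2 : ℝ)) := by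
  have n1 : ∀ p, 0 ≤ H1 p := fun p => (n0 p).trans (le p)
  have i21 : ∀ K, 0 ≤ ∑ γ, H1 (β, γ) * gA2 (Z γ) K := fun K => hB2 _ (mono_right m1 β) (fun γ => n1 _) K
  have i20 : ∀ K, 0 ≤ ∑ γ, H0 (β, γ) * gA2 (Z γ) K := fun K => hB2 _ (mono_right m0 β) (fun γ => n0 _) K
  have i3 : ∀ K, 0 ≤ ∑ γ, H1 (β, γ) * gA3u (Z γ) K + ∑ γ, H0 (β, γ) * gA3l (Z γ) K := fun K => by
    rw [← Finset.sum_add_distrib]; exact hB3 _ _ (mono_right m0 β) (mono_right m1 β) (fun γ => n0 _) (fun γ => le _) K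
  have i4b : ∀ K, 0 ≤ ∑ γ, H1 (β, γ) * gA4u (Z γ) K + ∑ γ, H1 (β, γ) * gA4l (Z γ) K := fun K => by
    rw [← Finset.sum_add_distrib]; exact hB4 _ _ (mono_right m1 β) (mono_right m1 β) (fun γ => n1 _) (fun γ => le_rfl) K
  have i4n : ∀ K, 0 ≤ ∑ γ, H1 (β, γ) * gA4u (Z γ) K + ∑ γ, H0 (β, γ) * gA4l (Z γ) K := fun K => by
    rw [← Finset.sum_add_distrib]; exact hB4 _ _ (mono_right m0 β) (mono_right m1 β) (fun γ => n0 _) (fun γ => le _) K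
  have a1 := i21 (J - (Y β).t0.L); have a3 := i20 (J - (Y β).t0.L)
  have a5 := i3 (J - (Y β).t0.L); have a6 := i4b (J - (Y β).t1.L); have a7 := i4n (J - (Y β).t0.L); have a8 := i4n (J - (Y β).t1.L)
  simp only [gA2, gA3u, gA3l, gA4u, gA4l] at a1 a3 a5 a6 a7 a8
  generalize (Y β) = d at *
  obtain ⟨⟨L0, c0, cb0⟩, ⟨L1, c1, cb1⟩⟩ := d
  simp only [BDat.type] at *
  cases c0 <;> cases c1 <;> cases cb0 <;> cases cb1 <;>
    simp only [Cert.certZS, Cert.isC, Prod.mk.injEq, Bool.false_eq_true, Bool.true_eq_false, and_true, and_false,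
      and_self, ite_true, ite_false, zero_mul, one_mul, mul_zero, zero_add, add_zero,
      Int.cast_add, Int.cast_zero, mul_add, Finset.sum_add_distrib] <;>
    first | positivity | linarith

/-- **Base (B2) of the root-form reduction (abstract form).**  For two abstract one-special boxes with consistent local types satisfying A2
(pivot, virtual root deleted), A3n and A4n against monotone nested nonnegative weights, the nested root functional of the SERIES pair `B_y · B_z`
is nonnegative against every monotone nested nonnegative weight pair. [folklore] -/
theorem serPair_Mt_nonneg (Y : B → BDat) (Z : B' → BDat)
    (hcY : ∀ β, Cert.consistentB (Y β).type = true) (hcZ : ∀ γ, Cert.consistentB (Z γ).type = true)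
    (hA2 : ∀ h : B → ℝ, Monotone h → (∀ β, 0 ≤ h β) → ∀ K : ℤ, 0 ≤ ∑ β, h β * gA2 (Y β) K)
    (hA3 : ∀ h0 h1 : B → ℝ, Monotone h0 → Monotone h1 → (∀ β, 0 ≤ h0 β) → (∀ β, h0 β ≤ h1 β) → ∀ K : ℤ,
      0 ≤ ∑ β, (h1 β * gA3u (Y β) K + h0 β * gA3l (Y β) K))
    (hA4 : ∀ h0 h1 : B → ℝ, Monotone h0 → Monotone h1 → (∀ β, 0 ≤ h0 β) → (∀ β, h0 β ≤ h1 β) → ∀ K : ℤ,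
      0 ≤ ∑ β, (h1 β * gA4u (Y β) K + h0 β * gA4l (Y β) K))
    (hB2 : ∀ h : B' → ℝ, Monotone h → (∀ γ, 0 ≤ h γ) → ∀ K : ℤ, 0 ≤ ∑ γ, h γ * gA2 (Z γ) K)
    (hB3 : ∀ h0 h1 : B' → ℝ, Monotone h0 → Monotone h1 → (∀ γ, 0 ≤ h0 γ) → (∀ γ, h0 γ ≤ h1 γ) → ∀ K : ℤ,
      0 ≤ ∑ γ, (h1 γ * gA3u (Z γ) K + h0 γ * gA3l (Z γ) K))
    (hB4 : ∀ h0 h1 : B' → ℝ, Monotone h0 → Monotone h1 → (∀ γ, 0 ≤ h0 γ) → (∀ γ, h0 γ ≤ h1 γ) → ∀ K : ℤ,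
      0 ≤ ∑ γ, (h1 γ * gA4u (Z γ) K + h0 γ * gA4l (Z γ) K))
    {H0 H1 : B × B' → ℝ} (m0 : Monotone H0) (m1 : Monotone H1) (n0 : ∀ p, 0 ≤ H0 p) (le : ∀ p, H0 p ≤ H1 p) (J : ℤ) :
    0 ≤ Mt (serPair Y Z) H0 H1 J := by
  have key : ∀ p : B × B', H1 p * (serPair Y Z p).slot1 J + H0 p * (serPair Y Z p).slot0 J =
      (H1 p * ((Cert.certYS (Y p.1).type (Z p.2).type ((J - (Z p.2).t0.L) - (Y p.1).t0.L) ((J - (Z p.2).t1.L) - (Y p.1).t0.L)).1 : ℝ)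
        + H0 p * ((Cert.certYS (Y p.1).type (Z p.2).type ((J - (Z p.2).t0.L) - (Y p.1).t0.L) ((J - (Z p.2).t1.L) - (Y p.1).t0.L)).2 : ℝ))
      + (H1 p * ((Cert.certZS (Y p.1).type (Z p.2).type ((J - (Y p.1).t0.L) - (Z p.2).t0.L) ((J - (Y p.1).t1.L) - (Z p.2).t0.L)).1 : ℝ)
        + H0 p * ((Cert.certZS (Y p.1).type (Z p.2).type ((J - (Y p.1).t0.L) - (Z p.2).t0.L) ((J - (Y p.1).t1.L) - (Z p.2).t0.L)).2 : ℝ))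
      + (H1 p * ((Cert.rhoS (Y p.1).type (Z p.2).type (J - (Z p.2).t0.L - (Y p.1).t0.L)).1 : ℝ)
        + H0 p * ((Cert.rhoS (Y p.1).type (Z p.2).type (J - (Z p.2).t0.L - (Y p.1).t0.L)).2 : ℝ)) := by
    intro p
    have hy : Cert.certYS (Y p.1).type (Z p.2).type (J - (Z p.2).t0.L - (Y p.1).t0.L)
        (J - (Z p.2).t0.L - (Y p.1).t0.L - (Z p.2).type.dL)
        = Cert.certYS (Y p.1).type (Z p.2).type ((J - (Z p.2).t0.L) - (Y p.1).t0.L) ((J - (Z p.2).t1.L) - (Y p.1).t0.L) := by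
      have hd : (Z p.2).type.dL = (Z p.2).t1.L - (Z p.2).t0.L := rfl
      have h3 : J - (Z p.2).t0.L - (Y p.1).t0.L - (Z p.2).type.dL = (J - (Z p.2).t1.L) - (Y p.1).t0.L := by rw [hd]; ring
      rw [h3]
    have hz : Cert.certZS (Y p.1).type (Z p.2).type (J - (Z p.2).t0.L - (Y p.1).t0.L)
        (J - (Z p.2).t0.L - (Y p.1).t0.L - (Y p.1).type.dL)
        = Cert.certZS (Y p.1).type (Z p.2).type ((J - (Y p.1).t0.L) - (Z p.2).t0.L) ((J - (Y p.1).t1.L) - (Z p.2).t0.L) := by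
      have hd : (Y p.1).type.dL = (Y p.1).t1.L - (Y p.1).t0.L := rfl
      have h1 : J - (Z p.2).t0.L - (Y p.1).t0.L = (J - (Y p.1).t0.L) - (Z p.2).t0.L := by ring
      have h3 : J - (Z p.2).t0.L - (Y p.1).t0.L - (Y p.1).type.dL = (J - (Y p.1).t1.L) - (Z p.2).t0.L := by rw [hd]; ring
      rw [h3, h1]
    rw [slot1_linkS, slot0_linkS]
    simp only [Cert.rhoS, hy, hz]
    push_cast; ring
  unfold Mt
  rw [Finset.sum_congr rfl (fun p _ => key p), Finset.sum_add_distrib, Finset.sum_add_distrib]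
  refine add_nonneg (add_nonneg ?_ ?_) ?_
  · rw [Fintype.sum_prod_type_right]
    exact Finset.sum_nonneg fun γ _ => certYS_nonneg Y Z hA2 hA3 hA4 m0 m1 n0 le J γ
  · rw [Fintype.sum_prod_type]
    exact Finset.sum_nonneg fun β _ => certZS_nonneg Y Z hB2 hB3 hB4 m0 m1 n0 le J β
  · refine Finset.sum_nonneg fun p _ => ?_
    obtain ⟨h1, h2⟩ := Cert.rhoS_nonneg (Y p.1).type (Z p.2).type (hcY p.1) (hcZ p.2) (J - (Z p.2).t0.L - (Y p.1).t0.L)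
    have h1' : (0 : ℝ) ≤ ((Cert.rhoS (Y p.1).type (Z p.2).type (J - (Z p.2).t0.L - (Y p.1).t0.L)).1 : ℝ) := by exact_mod_cast h1
    have h2' : (0 : ℝ) ≤ ((Cert.rhoS (Y p.1).type (Z p.2).type (J - (Z p.2).t0.L - (Y p.1).t0.L)).1 : ℝ)
        + ((Cert.rhoS (Y p.1).type (Z p.2).type (J - (Z p.2).t0.L - (Y p.1).t0.L)).2 : ℝ) := by exact_mod_cast h2
    nlinarith [n0 p, le p]

end Halves

end BaseSer

end RootForm

end FK

end Summit.CriticalPhenomena.PercolationContinuityZ3.Theorems
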